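import Summits.QuantumFields.YangMills.Theorems.BalabanUVNodesN18AtRateRecord13RunTowersGenBelow
import Summits.QuantumFields.YangMills.Theorems.BalabanUVNodesN18AtReadingOfRecord13CoP

/-!
# `CoP` (RECORD 13 v1.5) EDITION of `BalabanUVNodesN18AtRateRecord13RunTowersGenBelow` (p506380) — seat pub-ymgap-dag-n18-d (N18 = NE5, strategy s2), RE-KEYED on the proviso binder `Stage13Params.Provisos₁₃Core` (bg-free core, token-identical since v1.2) ∕ the datum `Node00.datumOfRecord₁₃CoP` (def-T's FILE 23 `Node00/Record13CoP`, p520810), RR-2's datum key `Node00.IsDatumOfRecord₁₃CCoP` (`Node00/Record13DatumKeyCoP`, p521571) and dag-n22-e's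
# (T-RATE) layer-B homes (`RateReading₁₃CoP`, `RRec₁₃CoP`, `RRec₁₃CoPOn`, `readingOfRecord₁₃CoP`, `s_N18_rRec₁₃CoP(On)_iff`, `forall_datumKey₁₃CoP_of_forall_admissible`, `readingOfRecord₁₃CoP_u3`)
#
# WHY (route `route-QuantumFields-BalabanUVNodes`; dag-lead KEY MAP of record): director-ym №160 (FINDING №7, fix F7; (4) EDITION FREEZE: v1.5 `CoP` is the LAST record edition before KEY-20; (5) «landed Co ∕ SepCo storeys STAND, their CoP twins are
# generator ∕ token work after FILE 23 ∕ 24T») RE-SEEDED RECORD 13 at print's 𝐓-weights ζ_j(Y) WITHOUT the small-field cut ([III] (1.11) p.248; def-T F7-a `Node00/TkWeightsOfRecordP`) and at the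
# co-divergent-class minimiser ON ITS SUPPORT Ω₀ ([15] p.277 (1)–(3); def-R F7-b `Node00/LargeFieldBackgroundCoPOfRecord`: `UbgMSCoPOfRecord`; def-T `UbgOfRecord₁₃CoP`); def-T re-generated the
# record family over those seeds (FILE 23, deprecate-and-add), RR-2 re-keyed the datum key (`IsDatumOfRecord₁₃CCoP` pins `D` to `datumOfRecord₁₃CoP` — another datum than v1.4's
# `datumOfRecord₁₃Co`, no bridge statable), the (T-RATE) layer B re-keyed its homes on it (KEY-RULE-21, token `Co ↦ CoP`), and a theorem binding the v1.4 datum key cannot be fed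
# from the v1.5 one — so every storey binding a Stage-13 datum key is re-keyed ONCE more (the v1.4 `…13Co…` twins STAND as landed siblings).  A v1.5 item's tuple
# `(θ, h : θ.Provisos₁₃SepCoP F N)` is served by `hc := h.toCore`, the datum agreeing by `rfl` (def-T `datumOfRecord₁₃SepCoP_eq_coP`; RR-2 `IsDatumOfRecord₁₃CSepCoP.toCoP`).  THIS FILE is the twin of this seat's own ‴ module under the token map `Provisos₁₃ ↦ Provisos₁₃Core` ·
# `datumOfRecord₁₃ ↦ datumOfRecord₁₃CoP` · `IsDatumOfRecord₁₃C ↦ IsDatumOfRecord₁₃CCoP` · `RateReading₁₃ ↦ RateReading₁₃CoP` · `RRec₁₃ ↦ RRec₁₃CoP` · `RRec₁₃On ↦ RRec₁₃CoPOn` ·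
# `readingOfRecord₁₃ ↦ readingOfRecord₁₃CoP` · `s_N18_rRec₁₃(On)_iff ↦ s_N18_rRec₁₃CoP(On)_iff` · `forall_datumKey₁₃_of_forall_admissible ↦ forall_datumKey₁₃CoP_of_forall_admissible`, and in
# THIS seat's decl names `rRec₁₃ ↦ rRec₁₃CoP`, `readingOfRecord₁₃ ↦ readingOfRecord₁₃CoP`; statements = the ‴ statements under the map, proofs = the ‴ proofs VERBATIM.
# EVERYTHING θ-LEVEL IS UNCHANGED AND NOT RE-DECLARED (`Stage13Params`, `u3OfRecord₁₃`, the per-tuple faces and junctions of the original carry no proviso ∕ key and are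
# IMPORTED BY NAME — this module imports its ‴ original) — here: `hLayer_runTowers_toClusterTower_of_stepGen_lt`, `n18At_u3OfRecord₁₃_readingAdm_runTowers_toClusterTower_of_stepGen_lt`.
# ITEM IDS quoted in the ‴ header below (K3‴ `SpineGivenEndpointR13`, stmt-QuantumFields-19912; K0‴) are ASIDES; this file is filed as a HELPER on the K3 item of the
# dag-lead KEY MAP of record — COUNT-NEUTRAL, no stub closed, N18 NOT discharged, no inhabitant of any key claimed (K0 OPEN).
#
# ‴ HEADER OF RECORD FOLLOWS (token-mapped; its decl list is this file's, the θ-only names above excepted):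
#
# BalabanUVNodes ∕ node N18 = NE5 — N18 AT THE STAGE-13 HOMES FOR THE GENERATED RUN TOWERS, THE PER-GENERATOR SCHEMA (GEN) ASKED BELOW THE RUN LENGTH ONLY:
# steps `m < k` for run A's generator `G k`, steps `m < k + 1` for run B's generator `G (k+1)` — per tuple and run length, unguarded and at the regime-restricted home
# (Track A, DAG node N18 = `T4OutputRate.NE5` :211; cluster K4 «SpineRates», item K3⁗ `SpineGivenEndpointR13Sep` ∕ K3‴; module 18g of seat pub-ymgap-dag-n18-d, strategy s2)

HONEST FRAMING.  Count-neutral kernel bookkeeping (`--supports … --as helper`), composition BY NAME of landed theorems; NE5 is NOT PRINTED and NOT proved;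
N18 is NOT discharged; no inhabitant of `IsDatumOfRecord₁₃CCoP` is claimed (K0 OPEN); the generators `G`, THE END's data and the schema (GEN) are
PARAMETERS ∕ HYPOTHESES.

WHY.  Module 18e (`…N18AtRateRecord13RunTowersGen`, p503555) knitted N18 at the Stage-13 homes for the GENERATED RUN TOWERS `runTowers (k ↦ toClusterTower (G F θ k))`
— the tower family dag-n27-c's XLII and dag-n22-e's 8b″ read — from THE END's data + dag-n18-c's per-generator schema (GEN), with (GEN) asked at EVERY step of the
generators `G k`, `G (k+1)` (the binder of dag-n18-c's producer `hLayer_toClusterTower_of_stepGen`).  But the run of `k` steps on the `k`-th torus performs the steps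
`m = 0, …, k − 1` only ([I] (0.23)–(0.24): «E_k = Σ_{j=1}^{k} E^{(j)}»; W1's `runTowers S k := truncRun k (S k)`): the schema instances at steps `m ≥ k` concern terms the run
never creates, on blocks that outgrow the torus — inputs NODE A is never asked to supply in print, and which a generator of record need not satisfy (cf. dag-lead's
LOCATED-C2-RUNS on torus-wrapping runs).  THIS FILE removes them: (GEN) for `G k` is asked at the steps `m < k` and for `G (k+1)` at the steps `m < k + 1` ONLY —
dag-n22-e 8b″'s `m < k` indexation for the N22 schemas on the same generators.  The device (§1): dag-n18-c's producer run on the table family CUT AT THE RUN LENGTH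
(`sp j` for `j ≤ K`, the EMPTY table beyond, where (GEN) and the restriction property hold outright), read back below the run length by W1's eliminator `truncRun_cases`,
the termless steps beyond by `analyticH_termlessTower` ∕ `bound238_termlessTower`; then module 18 §1's junction at `S := runTowers (k ↦ toClusterTower (G k))` (§2) and the
family rows (§3), VERBATIM module 18e's but for the two step binders.

WHAT (all `theorem`, 0 `def`).
* §1 `hLayer_runTowers_toClusterTower_of_stepGen_lt` (the run tower's (2.38) pair at every level from (GEN) below the run length).
* §2 ★ `n18At_u3OfRecord₁₃_readingAdm_runTowers_toClusterTower_of_stepGen_lt` (ONE tuple, ONE run length; hypothesis = module 18e §2's with `∀ m < k` ∕ `∀ m < k + 1`).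
* §3 ★ `s_N18_rRec₁₃CoP_readingAdm_runTowers_toClusterTower_of_stepGen_lt_pin` (unguarded home), ★ `s_N18_rRec₁₃CoPOn_readingAdm_runTowers_toClusterTower_of_stepGen_lt_pin`
  (regime home).

One finite four-torus programme at fixed `ε`; NOT the continuum limit, NOT OS, NOT a mass gap, NOT Clay.  0 `def`, 0 `sorry`.  Sources (TYPES only): T. Bałaban,
CMP **109** (1987) [Balaban1987RG1] (0.23)–(0.25) pp. 256–257, Thm 1 p. 259, (1.18) p. 263, (2.12)–(2.13) p. 268; CMP **116** (1988) [Balaban1988RG2Cluster] (1.41)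
p. 11, (2.13)–(2.14) pp. 14–15, Lemma 3 (2.38) p. 20; CMP **122** (1989) [Balaban1989LargeFieldII] (the record's stage).
-/

noncomputable section

open Set Metric
open scoped Matrix.Norms.L2Operator

namespace YMDAG.N18.W1Reading

open Literature.MathematicalPhysics.QuantumFieldTheory.Balaban1983to89
open Literature.MathematicalPhysics.QuantumFieldTheory.Balaban1983to89.T4Continuum
open Literature.MathematicalPhysics.QuantumFieldTheory.Balaban1983to89.T4OutputRate (Carriers Functional NE5 DecayBound Window)
open Literature.MathematicalPhysics.QuantumFieldTheory.Balaban1983to89.T4InputCauchyRateData (StepModel)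
open Literature.MathematicalPhysics.QuantumFieldTheory.Balaban1983to89.B13Resummation (locE)
open Literature.MathematicalPhysics.QuantumFieldTheory.Balaban1983to89.TreeLengthTorus (TDom tsys torusTreeLen)
open Literature.MathematicalPhysics.QuantumFieldTheory.Balaban1983to89.TreeLengthTorusGeometry (TTouch)
open Literature.MathematicalPhysics.QuantumFieldTheory.Balaban1983to89.B12TreeDecay (K₀)
open Literature.MathematicalPhysics.QuantumFieldTheory.Balaban1983to89.Node00 (Stage12Params Stage13Params IsDatumOfRecord₁₃CCoP datumOfRecord₁₃CoP U3Letters₁₁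
  U3Objects₁₁ NE2Objects₁₁ NE3Letters₁₁ prependCoupling MatA ιSU avOfRecord)
open Literature.MathematicalPhysics.QuantumFieldTheory.Balaban1983to89.Node00.Sect2 (domCount domSys CPair ofBackgroundC)
open Literature.MathematicalPhysics.QuantumFieldTheory.Balaban1983to89.Node00.W1 (ReadingData LevelPairing LetterInputs ClusterTower ClusterStep pairOfRecord
  dj_pairOfRecord functionalC functional termC box SpRestr AdmBg GenTower OlderTerms toClusterTower truncRun runTowers termlessTower truncRun_cases
  functionalC_truncRun_of_le functionalC_truncRun_eq_zero)
open Summit.QuantumFields.BalabanUV.T4Continuum.B13Carriers (transportRaw)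
open Summit.QuantumFields.BalabanUV.T4Continuum.Spine.NE5
open Summit.QuantumFields.YangMills.BalabanUVNodes.N18HLayerW1Config (analyticH_termlessTower bound238_termlessTower)
open Summit.QuantumFields.YangMills.BalabanUVNodes.N18HLayerW1Recursion (hLayer_toClusterTower_of_stepGen)
open YMDAG.N18.HLayer
open YMDAG.UVSplit

variable {N : ℕ} [NeZero N]

/-! ## §3 The family rows at the Stage-13 homes for generated run towers -/

section Record

variable (𝔯 : RateReading₁₃CoP N) (Rg : (F : T4Family) → Stage13Params F N → Prop)
  (G : (F : T4Family) → (θ : Stage13Params F N) → (k : ℕ) → GenTower (F.P k) (MatA N) θ.τ9.M)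
  (D : (F : T4Family) → Stage13Params F N → ℕ → Set ℂ)
  (sp : (F : T4Family) → (θ : Stage13Params F N) → (k j : ℕ) → (domSys (F.P k) θ.τ9.M j).Dom → Set (CPair (F.P k) (MatA N)))
  (gauge : (F : T4Family) → (θ : Stage13Params F N) → (k : ℕ) → GaugeField (F.P k) 0 (Node00.SU N) → GaugeField (F.P k) 0 (Node00.SU N) → ℝ)
  (hg : ∀ (F : T4Family) (θ : Stage13Params F N) (k : ℕ) (U U' : GaugeField (F.P k) 0 (Node00.SU N)), 0 ≤ gauge F θ k U U')
  (T₀ : (F : T4Family) → (θ : Stage13Params F N) → (k : ℕ) → GaugeField (F.P (k + 1)) 0 (Node00.SU N) → GaugeField (F.P k) 0 (Node00.SU N))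
  (hT : ∀ (F : T4Family) (θ : Stage13Params F N) (k : ℕ) (U : GaugeField (F.P (k + 1)) 0 (Node00.SU N)),
    (∀ (j : ℕ) (Y : (domSys (F.P (k + 1)) θ.τ9.M j).Dom), ofBackgroundC (ιSU N) U ∈ sp F θ (k + 1) j Y) →
      ∀ (j : ℕ) (X : (domSys (F.P k) θ.τ9.M j).Dom), ofBackgroundC (ιSU N) (T₀ F θ k U) ∈ sp F θ k j X)
  (li : (F : T4Family) → Stage13Params F N → LetterInputs)
  (hpin : ∀ (F : T4Family) (θ : Stage13Params F N) (hP : θ.Provisos₁₃Core F N) (g₀ : ℕ → ℝ) (os : List (ULoop F)),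
    (𝔯.lit F θ hP g₀ os).u3 =
      (ReadingData.ofRecordAdm F θ.τ9.M N (runTowers fun k => toClusterTower (G F θ k)) (sp F θ) (gauge F θ) (hg F θ) (T₀ F θ) (hT F θ) (li F θ)).u3Objects θ.γ)

include hpin in
open Classical in
/-- ★ **THE (GEN)-BELOW-THE-RUN-LENGTH ROW AT THE STAGE-13 HOME FOR THE GENERATED RUN TOWERS** [bookkeeping; §2 at every admissible Stage-13 tuple with provisos and every run length,
module 18's `s_N18_rRec₁₃CoP_of_forall_admissible_pin`]: for a reading pinned to the admissible reading family whose towers are the GENERATED RUN TOWERS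
`runTowers (k ↦ toClusterTower (G F θ k))` (tables `sp F θ`, transports `T₀ F θ` with clause `hT`, letters `li F θ`, coupling domains `D F θ k`): if at EVERY admissible
Stage-13 tuple `θ` with `Provisos₁₃Core` and every run length `k` there are (i) THE END's data over the carriers of the admissible level pairing (functionals of the run
towers) and (ii) (GEN) for both runs' generators on their tables BELOW THE RUN LENGTHS (`m < k` ∕ `m < k + 1`) with the STRICT clauses, renewals and
`]0, γ′] ⊆ D F θ k`, the letters dominating — then `S_N18 (RRec₁₃CoP 𝔯)`.  Module 18e's row with the bounded step binders. [cite: Balaban1987RG1, (0.23)–(0.25) pp.256–257, Thm 1 p.259, (1.18) p.263 and (2.12)–(2.13) p.268;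
Balaban1988RG2Cluster, (1.41) p.11, (2.13)–(2.14) pp.14–15, Lemma 3 (2.38) p.20] -/
theorem s_N18_rRec₁₃CoP_readingAdm_runTowers_toClusterTower_of_stepGen_lt_pin
    (h : ∀ (F : T4Family) (θ : Stage13Params F N), θ.Provisos₁₃Core F N → θ.Admissible F N → ∀ k : ℕ,
      ∃ (Op : Type) (_ : NormedAddCommGroup Op) (_ : NormedSpace ℂ Op) (Hist : Type) (_ : NormedAddCommGroup Hist) (_ : NormedSpace ℂ Hist)
        (Mb : ℝ → StepModel (LevelPairing.ofRecordAdm F θ.τ9.M N k (sp F θ) (gauge F θ k) (hg F θ k) (T₀ F θ k) (hT F θ k)).carriers Op Hist)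
        (act : ℝ → (j : ℕ) → Op × Hist → TDom 4 (domCount (F.P k) θ.τ9.M j) → ℂ) (γ' C3 ε₁ Rd κ A_A A_B E_A E_B E₁ δ δ' θr θ' cH ω ρ₀ B : ℝ)
        (k₀ : ℕ),
        (∀ b : ℝ, 0 < b → b ≤ γ' → ∀ (X : Node00.W1.Dom (F.P k) θ.τ9.M) (z : Op × Hist),
          (Mb b).Out X.1 z.1 z.2 X =
            locE (TTouch (d := 4) (N := domCount (F.P k) θ.τ9.M X.1)) (fun Z : (tsys 4 (domCount (F.P k) θ.τ9.M X.1)).Dom => Z.1)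
              (act b X.1 z) X.2.1) ∧
        0 ≤ C3 ∧ 0 ≤ ε₁ ∧ 0 ≤ κ ∧ κ + 2 * (64 * Real.log 162) + 2 ≤ Rd ∧
        C3 * ε₁ * Real.exp (5 * κ + 1) * K₀ 64 8 * 9 * 64 ≤ 1 ∧
        (∀ b : ℝ, 0 < b → b ≤ γ' → ∀ j, ∀ g ∈ Window γ',
          ∀ (U : (LevelPairing.ofRecordAdm F θ.τ9.M N k (sp F θ) (gauge F θ k) (hg F θ k) (T₀ F θ k) (hT F θ k)).BgB) (q : Op × Hist),
          q ∈ (Mb b).Base j g U →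
          ∃ V : Set (Op × Hist), IsOpen V ∧ (Mb b).box j q ⊆ V ∧
            (∀ Z : TDom 4 (domCount (F.P k) θ.τ9.M j), DifferentiableOn ℂ (fun z : Op × Hist => act b j z Z) V) ∧
            (∀ z ∈ V, ∀ Z : TDom 4 (domCount (F.P k) θ.τ9.M j), ‖act b j z Z‖ ≤ C3 * ε₁ * Real.exp (-(Rd * torusTreeLen Z.1)))) ∧
        (∀ b : ℝ, 0 < b → b ≤ γ' → L01 (Mb b)
          ((LevelPairing.ofRecordAdm F θ.τ9.M N k (sp F θ) (gauge F θ k) (hg F θ k) (T₀ F θ k) (hT F θ k)).EA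
            (runTowers (fun k => toClusterTower (G F θ k)) k)) (Window γ')) ∧
        (∀ b : ℝ, 0 < b → b ≤ γ' → L02 (Mb b)
          ((LevelPairing.ofRecordAdm F θ.τ9.M N k (sp F θ) (gauge F θ k) (hg F θ k) (T₀ F θ k) (hT F θ k)).EB
            (runTowers (fun k => toClusterTower (G F θ k)) (k + 1)) b) (Window γ')) ∧
        (∀ b : ℝ, 0 < b → b ≤ γ' → L03 (Mb b)
          ((LevelPairing.ofRecordAdm F θ.τ9.M N k (sp F θ) (gauge F θ k) (hg F θ k) (T₀ F θ k) (hT F θ k)).EB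
            (runTowers (fun k => toClusterTower (G F θ k)) (k + 1)) b) (Window γ')) ∧
        (∀ b : ℝ, 0 < b → b ≤ γ' → L07 (Mb b) (Window γ') δ θr) ∧
        (∀ b : ℝ, 0 < b → b ≤ γ' → L08 (Mb b) (Window γ') κ (Real.exp 1 * 9 * 64 * K₀ 64 8 ^ 2 * A_B) δ' θr) ∧
        (∀ b : ℝ, 0 < b → b ≤ γ' → L09aff (Mb b) (Window γ')) ∧ (∀ b : ℝ, 0 < b → b ≤ γ' → L09blind (Mb b) (Window γ')) ∧
        (∀ b : ℝ, 0 < b → b ≤ γ' → L09hom (Mb b) (Window γ')) ∧ (∀ b : ℝ, 0 < b → b ≤ γ' → L09unit (Mb b) (Window γ') κ E₁ cH ω) ∧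
        0 < E₁ ∧ 0 ≤ δ + δ' ∧ 0 ≤ θr ∧ θr ≤ θ' ∧ θ' ≤ 1 ∧ 0 ≤ cH ∧ 0 < ω ∧ ρ₀ < 1 ∧
        (δ + δ') * θr ^ k₀ +
            cH * (Real.exp 1 * 9 * 64 * K₀ 64 8 ^ 2 * A_A + Real.exp 1 * 9 * 64 * K₀ 64 8 ^ 2 * A_B) / (1 - ω) ≤ ρ₀ ∧
        0 ≤ B ∧ (∀ k < k₀, Real.exp 1 * 9 * 64 * K₀ 64 8 ^ 2 * A_A + Real.exp 1 * 9 * 64 * K₀ 64 8 ^ 2 * A_B ≤ B * θr ^ k) ∧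
        Real.exp 1 * 9 * 64 * K₀ 64 8 ^ 2 * C3 * cH * ε₁ < (θ' - ω) * (1 - ρ₀) ∧
        (∀ m, SpRestr (sp F θ k (m + 1))) ∧
        (∀ m < k, ∀ t ∈ D F θ k, ∀ old : OlderTerms (F.P k) (MatA N) θ.τ9.M m,
          (∀ (j : Fin (m + 1)) (Y : (domSys (F.P k) θ.τ9.M j).Dom), ∀ ψ ∈ sp F θ k j Y,
              ‖old j Y ψ‖ ≤ E_A * Real.exp (-(κ * (domSys (F.P k) θ.τ9.M j).dj Y))) →
          (∀ (j : Fin (m + 1)) (Y : (domSys (F.P k) θ.τ9.M j).Dom), AnalyticOnNhd ℂ (old j Y) (sp F θ k j Y)) →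
          (∀ Z : (domSys (F.P k) θ.τ9.M (m + 1)).Dom, AnalyticOnNhd ℂ (fun φ => (G F θ k m).H t old φ Z) (sp F θ k (m + 1) Z)) ∧
          (∀ (Z : (domSys (F.P k) θ.τ9.M (m + 1)).Dom), ∀ φ ∈ sp F θ k (m + 1) Z,
              ‖(G F θ k m).H t old φ Z‖ ≤ A_A * Real.exp (-(Rd * (domSys (F.P k) θ.τ9.M (m + 1)).dj Z)))) ∧
        0 ≤ A_A ∧ A_A * Real.exp (5 * κ + 1) * K₀ 64 8 * 9 * 64 < 1 ∧ Real.exp 1 * 9 * 64 * K₀ 64 8 ^ 2 * A_A ≤ E_A ∧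
        (∀ m, SpRestr (sp F θ (k + 1) (m + 1))) ∧
        (∀ m < k + 1, ∀ t ∈ D F θ k, ∀ old : OlderTerms (F.P (k + 1)) (MatA N) θ.τ9.M m,
          (∀ (j : Fin (m + 1)) (Y : (domSys (F.P (k + 1)) θ.τ9.M j).Dom), ∀ ψ ∈ sp F θ (k + 1) j Y,
              ‖old j Y ψ‖ ≤ E_B * Real.exp (-(κ * (domSys (F.P (k + 1)) θ.τ9.M j).dj Y))) →
          (∀ (j : Fin (m + 1)) (Y : (domSys (F.P (k + 1)) θ.τ9.M j).Dom), AnalyticOnNhd ℂ (old j Y) (sp F θ (k + 1) j Y)) →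
          (∀ Z : (domSys (F.P (k + 1)) θ.τ9.M (m + 1)).Dom, AnalyticOnNhd ℂ (fun φ => (G F θ (k + 1) m).H t old φ Z) (sp F θ (k + 1) (m + 1) Z)) ∧
          (∀ (Z : (domSys (F.P (k + 1)) θ.τ9.M (m + 1)).Dom), ∀ φ ∈ sp F θ (k + 1) (m + 1) Z,
              ‖(G F θ (k + 1) m).H t old φ Z‖ ≤ A_B * Real.exp (-(Rd * (domSys (F.P (k + 1)) θ.τ9.M (m + 1)).dj Z)))) ∧
        0 ≤ A_B ∧ A_B * Real.exp (5 * κ + 1) * K₀ 64 8 * 9 * 64 < 1 ∧ Real.exp 1 * 9 * 64 * K₀ 64 8 ^ 2 * A_B ≤ E_B ∧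
        (∀ s ∈ Ioc (0 : ℝ) γ', ((s : ℝ) : ℂ) ∈ D F θ k) ∧
        θ.γ ≤ γ' ∧ (li F θ).κ ≤ κ ∧ θ' ≤ (li F θ).θ₅ ∧
        (Real.exp 1 * 9 * 64 * K₀ 64 8 ^ 2 * (C3 * ε₁) / (1 - ρ₀) * (δ + δ') + B) * (θ' - ω) /
            (θ' - (ω + Real.exp 1 * 9 * 64 * K₀ 64 8 ^ 2 * (C3 * ε₁) / (1 - ρ₀) * cH)) ≤ (li F θ).C₅) :
    S_N18 (RRec₁₃CoP 𝔯) :=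
  s_N18_rRec₁₃CoP_of_forall_admissible_pin 𝔯 _ hpin fun F θ hP hA k =>
    n18At_u3OfRecord₁₃_readingAdm_runTowers_toClusterTower_of_stepGen_lt θ k (G F θ) (D F θ k) (sp F θ) (gauge F θ) (hg F θ) (T₀ F θ) (hT F θ) (li F θ)
      (h F θ hP hA k)

include hpin in
open Classical in
/-- ★ **THE (GEN)-BELOW-THE-RUN-LENGTH ROW FOR THE GENERATED RUN TOWERS AT THE REGIME-RESTRICTED HOME — THE DATA ASKED ONLY OF THE TUPLES IN THE REGIME** [bookkeeping; §2 under the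
guard, layer B's `s_N18_rRec₁₃CoPOn_iff`]: the same with (i)–(ii) asked only at the admissible tuples with `Provisos₁₃Core` IN `Rg` ⟹ `S_N18 (RRec₁₃CoPOn 𝔯 Rg)` — rev 16 ∕ 17's
guarded binder at `Rg F θ := θ.ZtUnity F N ∧ θ.SlotsNondegenerate₁₃ F N`. [cite: Balaban1987RG1, (0.23)–(0.25) pp.256–257, Thm 1 p.259 and (1.18) p.263; Balaban1988RG2Cluster, (2.13)–(2.14) pp.14–15 and Lemma 3 (2.38) p.20] -/
theorem s_N18_rRec₁₃CoPOn_readingAdm_runTowers_toClusterTower_of_stepGen_lt_pin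
    (h : ∀ (F : T4Family) (θ : Stage13Params F N), θ.Provisos₁₃Core F N → Rg F θ → θ.Admissible F N → ∀ k : ℕ,
      ∃ (Op : Type) (_ : NormedAddCommGroup Op) (_ : NormedSpace ℂ Op) (Hist : Type) (_ : NormedAddCommGroup Hist) (_ : NormedSpace ℂ Hist)
        (Mb : ℝ → StepModel (LevelPairing.ofRecordAdm F θ.τ9.M N k (sp F θ) (gauge F θ k) (hg F θ k) (T₀ F θ k) (hT F θ k)).carriers Op Hist)
        (act : ℝ → (j : ℕ) → Op × Hist → TDom 4 (domCount (F.P k) θ.τ9.M j) → ℂ) (γ' C3 ε₁ Rd κ A_A A_B E_A E_B E₁ δ δ' θr θ' cH ω ρ₀ B : ℝ)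
        (k₀ : ℕ),
        (∀ b : ℝ, 0 < b → b ≤ γ' → ∀ (X : Node00.W1.Dom (F.P k) θ.τ9.M) (z : Op × Hist),
          (Mb b).Out X.1 z.1 z.2 X =
            locE (TTouch (d := 4) (N := domCount (F.P k) θ.τ9.M X.1)) (fun Z : (tsys 4 (domCount (F.P k) θ.τ9.M X.1)).Dom => Z.1)
              (act b X.1 z) X.2.1) ∧
        0 ≤ C3 ∧ 0 ≤ ε₁ ∧ 0 ≤ κ ∧ κ + 2 * (64 * Real.log 162) + 2 ≤ Rd ∧
        C3 * ε₁ * Real.exp (5 * κ + 1) * K₀ 64 8 * 9 * 64 ≤ 1 ∧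
        (∀ b : ℝ, 0 < b → b ≤ γ' → ∀ j, ∀ g ∈ Window γ',
          ∀ (U : (LevelPairing.ofRecordAdm F θ.τ9.M N k (sp F θ) (gauge F θ k) (hg F θ k) (T₀ F θ k) (hT F θ k)).BgB) (q : Op × Hist),
          q ∈ (Mb b).Base j g U →
          ∃ V : Set (Op × Hist), IsOpen V ∧ (Mb b).box j q ⊆ V ∧
            (∀ Z : TDom 4 (domCount (F.P k) θ.τ9.M j), DifferentiableOn ℂ (fun z : Op × Hist => act b j z Z) V) ∧
            (∀ z ∈ V, ∀ Z : TDom 4 (domCount (F.P k) θ.τ9.M j), ‖act b j z Z‖ ≤ C3 * ε₁ * Real.exp (-(Rd * torusTreeLen Z.1)))) ∧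
        (∀ b : ℝ, 0 < b → b ≤ γ' → L01 (Mb b)
          ((LevelPairing.ofRecordAdm F θ.τ9.M N k (sp F θ) (gauge F θ k) (hg F θ k) (T₀ F θ k) (hT F θ k)).EA
            (runTowers (fun k => toClusterTower (G F θ k)) k)) (Window γ')) ∧
        (∀ b : ℝ, 0 < b → b ≤ γ' → L02 (Mb b)
          ((LevelPairing.ofRecordAdm F θ.τ9.M N k (sp F θ) (gauge F θ k) (hg F θ k) (T₀ F θ k) (hT F θ k)).EB
            (runTowers (fun k => toClusterTower (G F θ k)) (k + 1)) b) (Window γ')) ∧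
        (∀ b : ℝ, 0 < b → b ≤ γ' → L03 (Mb b)
          ((LevelPairing.ofRecordAdm F θ.τ9.M N k (sp F θ) (gauge F θ k) (hg F θ k) (T₀ F θ k) (hT F θ k)).EB
            (runTowers (fun k => toClusterTower (G F θ k)) (k + 1)) b) (Window γ')) ∧
        (∀ b : ℝ, 0 < b → b ≤ γ' → L07 (Mb b) (Window γ') δ θr) ∧
        (∀ b : ℝ, 0 < b → b ≤ γ' → L08 (Mb b) (Window γ') κ (Real.exp 1 * 9 * 64 * K₀ 64 8 ^ 2 * A_B) δ' θr) ∧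
        (∀ b : ℝ, 0 < b → b ≤ γ' → L09aff (Mb b) (Window γ')) ∧ (∀ b : ℝ, 0 < b → b ≤ γ' → L09blind (Mb b) (Window γ')) ∧
        (∀ b : ℝ, 0 < b → b ≤ γ' → L09hom (Mb b) (Window γ')) ∧ (∀ b : ℝ, 0 < b → b ≤ γ' → L09unit (Mb b) (Window γ') κ E₁ cH ω) ∧
        0 < E₁ ∧ 0 ≤ δ + δ' ∧ 0 ≤ θr ∧ θr ≤ θ' ∧ θ' ≤ 1 ∧ 0 ≤ cH ∧ 0 < ω ∧ ρ₀ < 1 ∧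
        (δ + δ') * θr ^ k₀ +
            cH * (Real.exp 1 * 9 * 64 * K₀ 64 8 ^ 2 * A_A + Real.exp 1 * 9 * 64 * K₀ 64 8 ^ 2 * A_B) / (1 - ω) ≤ ρ₀ ∧
        0 ≤ B ∧ (∀ k < k₀, Real.exp 1 * 9 * 64 * K₀ 64 8 ^ 2 * A_A + Real.exp 1 * 9 * 64 * K₀ 64 8 ^ 2 * A_B ≤ B * θr ^ k) ∧
        Real.exp 1 * 9 * 64 * K₀ 64 8 ^ 2 * C3 * cH * ε₁ < (θ' - ω) * (1 - ρ₀) ∧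
        (∀ m, SpRestr (sp F θ k (m + 1))) ∧
        (∀ m < k, ∀ t ∈ D F θ k, ∀ old : OlderTerms (F.P k) (MatA N) θ.τ9.M m,
          (∀ (j : Fin (m + 1)) (Y : (domSys (F.P k) θ.τ9.M j).Dom), ∀ ψ ∈ sp F θ k j Y,
              ‖old j Y ψ‖ ≤ E_A * Real.exp (-(κ * (domSys (F.P k) θ.τ9.M j).dj Y))) →
          (∀ (j : Fin (m + 1)) (Y : (domSys (F.P k) θ.τ9.M j).Dom), AnalyticOnNhd ℂ (old j Y) (sp F θ k j Y)) →
          (∀ Z : (domSys (F.P k) θ.τ9.M (m + 1)).Dom, AnalyticOnNhd ℂ (fun φ => (G F θ k m).H t old φ Z) (sp F θ k (m + 1) Z)) ∧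
          (∀ (Z : (domSys (F.P k) θ.τ9.M (m + 1)).Dom), ∀ φ ∈ sp F θ k (m + 1) Z,
              ‖(G F θ k m).H t old φ Z‖ ≤ A_A * Real.exp (-(Rd * (domSys (F.P k) θ.τ9.M (m + 1)).dj Z)))) ∧
        0 ≤ A_A ∧ A_A * Real.exp (5 * κ + 1) * K₀ 64 8 * 9 * 64 < 1 ∧ Real.exp 1 * 9 * 64 * K₀ 64 8 ^ 2 * A_A ≤ E_A ∧
        (∀ m, SpRestr (sp F θ (k + 1) (m + 1))) ∧
        (∀ m < k + 1, ∀ t ∈ D F θ k, ∀ old : OlderTerms (F.P (k + 1)) (MatA N) θ.τ9.M m,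
          (∀ (j : Fin (m + 1)) (Y : (domSys (F.P (k + 1)) θ.τ9.M j).Dom), ∀ ψ ∈ sp F θ (k + 1) j Y,
              ‖old j Y ψ‖ ≤ E_B * Real.exp (-(κ * (domSys (F.P (k + 1)) θ.τ9.M j).dj Y))) →
          (∀ (j : Fin (m + 1)) (Y : (domSys (F.P (k + 1)) θ.τ9.M j).Dom), AnalyticOnNhd ℂ (old j Y) (sp F θ (k + 1) j Y)) →
          (∀ Z : (domSys (F.P (k + 1)) θ.τ9.M (m + 1)).Dom, AnalyticOnNhd ℂ (fun φ => (G F θ (k + 1) m).H t old φ Z) (sp F θ (k + 1) (m + 1) Z)) ∧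
          (∀ (Z : (domSys (F.P (k + 1)) θ.τ9.M (m + 1)).Dom), ∀ φ ∈ sp F θ (k + 1) (m + 1) Z,
              ‖(G F θ (k + 1) m).H t old φ Z‖ ≤ A_B * Real.exp (-(Rd * (domSys (F.P (k + 1)) θ.τ9.M (m + 1)).dj Z)))) ∧
        0 ≤ A_B ∧ A_B * Real.exp (5 * κ + 1) * K₀ 64 8 * 9 * 64 < 1 ∧ Real.exp 1 * 9 * 64 * K₀ 64 8 ^ 2 * A_B ≤ E_B ∧
        (∀ s ∈ Ioc (0 : ℝ) γ', ((s : ℝ) : ℂ) ∈ D F θ k) ∧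
        θ.γ ≤ γ' ∧ (li F θ).κ ≤ κ ∧ θ' ≤ (li F θ).θ₅ ∧
        (Real.exp 1 * 9 * 64 * K₀ 64 8 ^ 2 * (C3 * ε₁) / (1 - ρ₀) * (δ + δ') + B) * (θ' - ω) /
            (θ' - (ω + Real.exp 1 * 9 * 64 * K₀ 64 8 ^ 2 * (C3 * ε₁) / (1 - ρ₀) * cH)) ≤ (li F θ).C₅) :
    S_N18 (RRec₁₃CoPOn 𝔯 Rg) := by
  rw [s_N18_rRec₁₃CoPOn_iff]
  intro F θ hP hRg hA g₀ os k
  rw [hpin]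
  exact n18At_u3OfRecord₁₃_readingAdm_runTowers_toClusterTower_of_stepGen_lt θ k (G F θ) (D F θ k) (sp F θ) (gauge F θ) (hg F θ) (T₀ F θ) (hT F θ) (li F θ)
    (h F θ hP hRg hA k)

end Record

end YMDAG.N18.W1Reading

end
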